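import Mathlib
import Summits.Langlands.Langlands.Theses.PhantomRMYoshida
import Summits.Langlands.Langlands.Theorems.PhantomRMYoshidaStableYoshidaCongruenceResidualLattice
import Summits.Langlands.Langlands.Theorems.PhantomRMYoshidaStableYoshidaCongruenceOrdinaryFrameFp
import Literature.NumberTheory.NumberFields.CongruenceSubgroupTorsionFree
import HarnessLib

/-!
# Route `PhantomRMYoshida`, crux `StableYoshidaCongruence` (stmt-Langlands-13640): the
# non-conjugacy hypothesis is idle

Helper file (`--supports stmt-Langlands-13640`, line lead c20, 2026-08-17).  It does NOT close the
crux.  It proves, against the route declaration BY NAME, that hypothesis (H4) of the crux —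
`¬ ∃ g : GL₂(k), ∀ x, g σ x g⁻¹ = σ' x` ("`σ̄'` is not conjugate to `σ̄`") — is DERIVABLE from the
determinant hypothesis (H3a) `det σ = ε̄⁻¹` and the witness hypothesis (H5) `∃ ρ, Sh ρ` (in fact from
its Greenberg/distinguishedness and residual-pair clauses alone):
`stableYoshidaCongruence_iff_dropNonConj`.  The standing disprover's file
(`Cruxes/StableYoshidaCongruence/Disproof.lean`, §4 "H3b and H4 are DERIVABLE from H5 (sketch)")
flagged this as an unverified sketch; here is the kernel-checked version for H4.

Proof (`nonConj_of_det_of_ordinary_of_hasResidualPair`).  Let `v ∣ p`.  By the landed Stub 4 of line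
`burkhardt-weddle-two-three-anchor` (`stub_residualLattice`: stable lattice adapted to the Greenberg
flag, Chebotarev, Brauer–Nesbitt — all proved in the tree) the witness `ρ` has a continuous residual
model `M : Γ_ℚ → GL₄(k)` with `charpoly M = charpoly σ · charpoly σ'` everywhere, block upper
triangular on `Γ_{ℚ_v}` with upper triangular top block, whose two top diagonal characters
`a, d : Γ_{ℚ_v} → kˣ` are trivial on inertia and DISTINCT at some `τ₀`.  If `σ' = g σ g⁻¹` then
`charpoly M(τ) = (charpoly σ(τ))²` for `τ ∈ Γ_{ℚ_v}`; both `a(τ)` and `d(τ)` are roots of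
`charpoly M(τ)` (the shape of `M(τ)`), hence of the quadratic `charpoly σ(τ)`, so whenever
`a(τ) ≠ d(τ)` Vieta gives `det σ(τ) = a(τ) d(τ)`.  Apply this at `τ₀` and at `τ₀ ι` for an inertia
element `ι` with `ε̄(ι) ≠ 1` (`p` odd; landed `exists_mem_absInertia_epsBar_ne_one`): the right-hand
side does not see `ι`, so `det σ(ι) = 1`, while `det σ(ι) = ε̄(ι)⁻¹ ≠ 1`.  Contradiction.

Consequences recorded: `nonConj_of_detCond_of_sh` (in the vocabulary of the landed sector file,
`DetCond`/`Sh`/`NonConj`), and `stableYoshidaCongruence_iff_dropNonConj` — the route's crux is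
equivalent to the same statement with (H4) deleted.  So (H4) carries no content and may be dropped
from the crux and from both children of `Cruxes/StableYoshidaCongruence/SPLIT.md` at a restatement.
[folklore]
-/

set_option linter.dupNamespace false -- `Summit.Langlands.Langlands` is the mandated namespace (D-0017)

noncomputable section

open Literature.NumberTheory.GaloisRepresentations Literature.NumberTheory.Automorphic
open IsDedekindDomain Matrix Polynomial
open scoped NumberField
open Summit.Langlands.Langlands.Theses.PhantomRMYoshida
open Summit.Langlands.Langlands.Cruxes.StableYoshidaCongruence.LevelThreeWeierstrassSwitch
  (epsBar Sh AutGL2 AutGL4 DetCond NonConj CruxAt crux_iff)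
open Summit.Langlands.Langlands.Cruxes.StableYoshidaCongruence.BurkhardtWeddleTwoThreeAnchor
  (stub_residualLattice exists_mem_absInertia_epsBar_ne_one det_val_eq_of_det_eq)

namespace Summit.Langlands.Langlands.Theorems.PhantomRMYoshida

/-! ## Linear algebra: the two top diagonal entries of a `(1,1,2)`-block-triangular matrix are
eigenvalues -/

/-- For a `4 × 4` matrix `N` over an integral domain with `N 1 0 = N 2 0 = N 3 0 = N 2 1 = N 3 1 = 0`
(block upper triangular of type `(1, 1, 2)`), the diagonal entries `N 0 0` and `N 1 1` are roots of
the characteristic polynomial: `e₀` is an eigenvector for `N 0 0`, and `(N 0 1, N 1 1 - N 0 0, 0, 0)`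
is a kernel vector of `N 1 1 - N` (or `N 1 1 = N 0 0`). [folklore] -/
theorem charpoly_eval_diag_eq_zero_of_blockShape {K : Type*} [CommRing K] [IsDomain K]
    (N : Matrix (Fin 4) (Fin 4) K) (h10 : N 1 0 = 0) (h20 : N 2 0 = 0) (h30 : N 3 0 = 0)
    (h21 : N 2 1 = 0) (h31 : N 3 1 = 0) :
    N.charpoly.eval (N 0 0) = 0 ∧ N.charpoly.eval (N 1 1) = 0 := by
  have h1 : N.charpoly.eval (N 0 0) = 0 := by
    rw [Matrix.eval_charpoly]
    exact Matrix.det_eq_zero_of_column_eq_zero 0 fun i => by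
      fin_cases i <;> simp [Matrix.scalar_apply, Matrix.diagonal, h10, h20, h30]
  refine ⟨h1, ?_⟩
  by_cases h : N 1 1 = N 0 0
  · rw [h]; exact h1
  rw [Matrix.eval_charpoly, ← Matrix.exists_mulVec_eq_zero_iff]
  refine ⟨![N 0 1, N 1 1 - N 0 0, 0, 0], fun hv => h ?_, ?_⟩
  · have := congr_fun hv 1
    simp only [Matrix.cons_val_one, Matrix.cons_val_zero, Pi.zero_apply] at this
    exact (sub_eq_zero.mp this)
  · ext i
    fin_cases i <;>
      simp [Matrix.mulVec, dotProduct, Fin.sum_univ_four, Matrix.scalar_apply, Matrix.diagonal,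
        h10, h20, h30, h21, h31]
    ring

/-! ## The idle-hypothesis theorem -/

section Main

variable {p : ℕ} [Fact p.Prime] {k : Type} [Field k] [CharP k p] [TopologicalSpace k]
  [DiscreteTopology k]

/-- **(H4) from (H3a) + (H5).**  `p` odd; `σ, σ' : Γ_ℚ → GL₂(k)` with `det σ = ε̄⁻¹`;
`ρ : Γ_ℚ → GL₄(ℚ̄_p)` Greenberg-ordinary of shape `(0,0,1,1)` and residually distinguished at the
places above `p`, with residual pair `(σ, σ')` through `red`.  Then `σ'` is NOT `GL₂(k)`-conjugate
to `σ`.  (Proof in the module docstring: residual model `M` of `stub_residualLattice`; under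
conjugacy `charpoly M = (charpoly σ)²` on `Γ_{ℚ_v}`; the two unramified top characters `a ≠ d` are
roots, so `det σ = a d` is inertia-invariant where `a ≠ d`, against `det σ = ε̄⁻¹` and
`ε̄(I_{ℚ_v}) ∋ -1 ≠ 1`.) [folklore] -/
theorem nonConj_of_det_of_ordinary_of_hasResidualPair (hp : p ≠ 2)
    {red : Valued.integer (PadicAlgCl p) →+* k} {σ σ' : FramedGaloisRep ℚ k 2}
    (hdet : ∀ g, FramedRep.det σ g =
      (Units.map (ZMod.castHom (dvd_refl p) k).toMonoidHom (epsBar p g))⁻¹)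
    {ρ : FramedGaloisRep ℚ (PadicAlgCl p) 4}
    (hord : ∀ v : HeightOneSpectrum (𝓞 ℚ), ((p : ℕ) : 𝓞 ℚ) ∈ v.asIdeal →
      ρ.IsGreenbergOrdinaryOfShapeAt v ![0, 0, 1, 1] ∧ ρ.IsResiduallyDistinguishedAt v ![0, 0, 1, 1])
    (hpair : ρ.HasResidualPair red σ σ') :
    ¬ ∃ g : GL (Fin 2) k, ∀ x, g * σ x * g⁻¹ = σ' x := by
  rintro ⟨g, hg⟩
  -- a place `v ∣ p`, the residual model `M`, an inertia element `ι` with `ε̄(ι) ≠ 1`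
  obtain ⟨v, hv⟩ :=
    Literature.NumberTheory.NumberFields.RingOfIntegers.exists_heightOneSpectrum_natCast_mem ℚ
      (Fact.out : p.Prime)
  obtain ⟨M, hM1, hM2, hM3, τ₀, hτ₀⟩ :=
    stub_residualLattice p hp k red σ σ' ρ v hv (hord v hv).1 (hord v hv).2 hpair
  obtain ⟨ι, hιI, hι⟩ := exists_mem_absInertia_epsBar_ne_one hp v hv
  set L := absGaloisRestrict ℚ (v.adicCompletion ℚ) with hL
  -- `charpoly σ' = charpoly σ` (conjugacy)
  have hconj : ∀ x, FramedRep.charpoly σ' x = FramedRep.charpoly σ x := by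
    intro x
    simp only [FramedRep.charpoly]
    rw [← hg x, Matrix.GeneralLinearGroup.coe_mul, Matrix.GeneralLinearGroup.coe_mul,
      Matrix.coe_units_inv]
    exact Matrix.charpoly_units_conj g _
  -- KEY: wherever the two top characters differ, `det σ = a d`
  have key : ∀ τ : Field.absoluteGaloisGroup (v.adicCompletion ℚ),
      (M.toLocal v τ).val 0 0 ≠ (M.toLocal v τ).val 1 1 →
      ((σ (L τ) : GL (Fin 2) k) : Matrix (Fin 2) (Fin 2) k).det =
        (M.toLocal v τ).val 0 0 * (M.toLocal v τ).val 1 1 := by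
    intro τ hne
    obtain ⟨h10, h20, h30, h21, h31⟩ := hM2 τ
    have hroots := charpoly_eval_diag_eq_zero_of_blockShape (M.toLocal v τ).val h10 h20 h30 h21 h31
    -- `charpoly (M τ) = (charpoly σ (L τ))²`
    have hfac : ((M.toLocal v τ).val).charpoly =
        FramedRep.charpoly σ (L τ) * FramedRep.charpoly σ (L τ) := by
      have h := hM1 (L τ)
      rw [hconj] at h
      exact h
    set S := ((σ (L τ) : GL (Fin 2) k) : Matrix (Fin 2) (Fin 2) k) with hS
    have hP : FramedRep.charpoly σ (L τ) = X ^ 2 - C S.trace * X + C S.det :=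
      Matrix.charpoly_fin_two S
    have ha : (X ^ 2 - C S.trace * X + C S.det : k[X]).eval ((M.toLocal v τ).val 0 0) = 0 := by
      have h := hroots.1
      rw [hfac, eval_mul, hP] at h
      exact mul_self_eq_zero.mp h
    have hd : (X ^ 2 - C S.trace * X + C S.det : k[X]).eval ((M.toLocal v τ).val 1 1) = 0 := by
      have h := hroots.2
      rw [hfac, eval_mul, hP] at h
      exact mul_self_eq_zero.mp h
    simp only [eval_add, eval_sub, eval_mul, eval_pow, eval_C, eval_X] at ha hd
    have hsub : ((M.toLocal v τ).val 0 0 - (M.toLocal v τ).val 1 1) *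
        ((M.toLocal v τ).val 0 0 + (M.toLocal v τ).val 1 1 - S.trace) = 0 := by
      linear_combination ha - hd
    have ht : S.trace - ((M.toLocal v τ).val 0 0 + (M.toLocal v τ).val 1 1) = 0 := by
      have h := (mul_eq_zero.mp hsub).resolve_left (sub_ne_zero.mpr hne)
      linear_combination -h
    linear_combination ha + ((M.toLocal v τ).val 0 0) * ht
  -- the top characters do not see inertia
  have h00 : (M.toLocal v (τ₀ * ι)).val 0 0 = (M.toLocal v τ₀).val 0 0 := by
    obtain ⟨h10, h20, h30, -, -⟩ := hM2 ι
    obtain ⟨hι00, -, -⟩ := hM3 ι hιI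
    rw [map_mul, Units.val_mul, Matrix.mul_apply, Fin.sum_univ_four, h10, h20, h30, hι00]
    ring
  have h11 : (M.toLocal v (τ₀ * ι)).val 1 1 = (M.toLocal v τ₀).val 1 1 := by
    obtain ⟨-, -, -, h21, h31⟩ := hM2 ι
    obtain ⟨-, hι11, hι01⟩ := hM3 ι hιI
    obtain ⟨h10', -, -, -, -⟩ := hM2 τ₀
    rw [map_mul, Units.val_mul, Matrix.mul_apply, Fin.sum_univ_four, h21, h31, hι11, hι01]
    ring
  -- compare `det σ` at `τ₀` and at `τ₀ ι`
  have h1 := key τ₀ hτ₀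
  have h2 := key (τ₀ * ι) (by rwa [h00, h11])
  rw [h00, h11, ← h1, map_mul, map_mul, Matrix.GeneralLinearGroup.coe_mul, Matrix.det_mul] at h2
  -- `h2 : det σ(L τ₀) * det σ(L ι) = det σ(L τ₀)`, so `det σ(L ι) = 1`
  have hunit : ((σ (L τ₀) : GL (Fin 2) k) : Matrix (Fin 2) (Fin 2) k).det ≠ 0 := by
    rw [← Matrix.GeneralLinearGroup.val_det_apply]
    exact Units.ne_zero _
  have hone : ((σ (L ι) : GL (Fin 2) k) : Matrix (Fin 2) (Fin 2) k).det = 1 := by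
    have h3 : ((σ (L τ₀) : GL (Fin 2) k) : Matrix (Fin 2) (Fin 2) k).det *
        (((σ (L ι) : GL (Fin 2) k) : Matrix (Fin 2) (Fin 2) k).det - 1) = 0 := by
      linear_combination h2
    exact sub_eq_zero.mp ((mul_eq_zero.mp h3).resolve_left hunit)
  -- but `det σ(L ι) = ε̄(ι)⁻¹ ≠ 1`
  rw [det_val_eq_of_det_eq (hdet (L ι)), ← map_one (ZMod.castHom (dvd_refl p) k)] at hone
  have hinj := (ZMod.castHom_injective k) hone
  exact hι (inv_eq_one.mp (Units.ext hinj))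

/-- **(H4) is idle, in the vocabulary of the landed sector file** (`DetCond`, `Sh`, `NonConj` of
`Theorems/PhantomRMYoshidaStableYoshidaCongruenceSector.lean`): `DetCond p σ σ'` and any `Sh`-witness
`ρ` give `NonConj σ σ'`. [folklore] -/
theorem nonConj_of_detCond_of_sh (hp : p ≠ 2) {red : Valued.integer (PadicAlgCl p) →+* k}
    {σ σ' : FramedGaloisRep ℚ k 2} (hdet : DetCond p σ σ')
    {ρ : FramedGaloisRep ℚ (PadicAlgCl p) 4} (hρ : Sh red σ σ' ρ) : NonConj σ σ' :=
  nonConj_of_det_of_ordinary_of_hasResidualPair hp (fun g => (hdet g).1) hρ.2.1 hρ.2.2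

end Main

/-- **The crux is equivalent to the crux with (H4) deleted.**  Left: the route declaration
`Theses.PhantomRMYoshida.StableYoshidaCongruence` by name.  Right: the same implication chain at
every datum `(p, k, red, σ, σ')` WITHOUT the non-conjugacy hypothesis
`¬ ∃ g : GL (Fin 2) k, ∀ x, g * σ x * g⁻¹ = σ' x`, written with the landed names
`AutGL2`/`DetCond`/`Sh`/`AutGL4` (each verbatim the route's `let`-abbreviation, cf. `crux_iff`,
which is `Iff.rfl`).  Direction `→` feeds the crux the non-conjugacy obtained from
`nonConj_of_detCond_of_sh`; direction `←` discards the hypothesis. [folklore] -/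
theorem stableYoshidaCongruence_iff_dropNonConj :
    StableYoshidaCongruence ↔
      ∀ (p : ℕ) [Fact p.Prime], p ≠ 2 → ∀ (k : Type) [Field k] [CharP k p] [IsAlgClosed k]
        [TopologicalSpace k] [DiscreteTopology k] (red : Valued.integer (PadicAlgCl p) →+* k)
        (σ σ' : FramedGaloisRep ℚ k 2),
        AutGL2 red σ → AutGL2 red σ' → σ.toGaloisRep.IsIrreducible → σ'.toGaloisRep.IsIrreducible →
          DetCond p σ σ' → (∃ ρ : FramedGaloisRep ℚ (PadicAlgCl p) 4, Sh red σ σ' ρ) →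
            ∀ (hcpt : isCompact_glFiniteIntegralLevel 4 ℚ) (ι : PadicAlgCl p ≃+* ℂ),
              ∃ ρ₀ : FramedGaloisRep ℚ (PadicAlgCl p) 4,
                ρ₀.toGaloisRep.IsIrreducible ∧ Sh red σ σ' ρ₀ ∧ AutGL4 p hcpt ι ρ₀ := by
  rw [crux_iff]
  constructor
  · intro h p _ hp k _ _ _ _ _ red σ σ' hA hA' hirr hirr' hdet hw hcpt ι
    obtain ⟨ρ, hρ⟩ := hw
    exact h p hp k red σ σ' hA hA' hirr hirr' hdet (nonConj_of_detCond_of_sh hp hdet hρ) ⟨ρ, hρ⟩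
      hcpt ι
  · intro h p _ hp k _ _ _ _ _ red σ σ' hA hA' hirr hirr' hdet _ hw hcpt ι
    exact h p hp k red σ σ' hA hA' hirr hirr' hdet hw hcpt ι

/-- **The same equivalence with the right-hand side in the ROUTE'S OWN SYNTAX**: verbatim the text of
`Theses.PhantomRMYoshida.StableYoshidaCongruence` (item stmt-Langlands-13640) with the single clause
`(¬ ∃ g : GL (Fin 2) k, ∀ x, g * σ x * g⁻¹ = σ' x) →` deleted — ready to paste as a restated crux.
It is definitionally the right-hand side of `stableYoshidaCongruence_iff_dropNonConj` (the `let`s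
zeta-reduce to the landed names), so the proof is that theorem followed by `Iff.rfl`. [folklore] -/
theorem stableYoshidaCongruence_iff_dropNonConj_verbatim : StableYoshidaCongruence ↔ (∀ (p : ℕ) [Fact p.Prime], p ≠ 2 → ∀ (k : Type) [Field k] [CharP k p] [IsAlgClosed k] [TopologicalSpace k] [DiscreteTopology k] (red : Valued.integer (PadicAlgCl p) →+* k) (σ σ' : Literature.NumberTheory.GaloisRepresentations.FramedGaloisRep ℚ k 2), let εb : Field.absoluteGaloisGroup ℚ →* (ZMod p)ˣ := (modularCyclotomicCharacter (AlgebraicClosure ℚ) (HasEnoughRootsOfUnity.natCard_rootsOfUnity (AlgebraicClosure ℚ) p)).comp (MulSemiringAction.toRingAut (Field.absoluteGaloisGroup ℚ) (AlgebraicClosure ℚ)); let Sh := fun r : Literature.NumberTheory.GaloisRepresentations.FramedGaloisRep ℚ (PadicAlgCl p) 4 => (r.IsSymplecticWithMultiplierFun (fun g => algebraMap ℚ_[p] (PadicAlgCl p) ((((Literature.NumberTheory.GaloisRepresentations.GaloisRep.cyclotomicCharacter ℚ p g)⁻¹ : ℤ_[p]ˣ) : ℤ_[p]) : ℚ_[p]))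 ∧ (∀ v : IsDedekindDomain.HeightOneSpectrum (NumberField.RingOfIntegers ℚ), ((p : ℕ) : NumberField.RingOfIntegers ℚ) ∈ v.asIdeal → r.IsGreenbergOrdinaryOfShapeAt v ![0, 0, 1, 1] ∧ r.IsResiduallyDistinguishedAt v ![0, 0, 1, 1]) ∧ (∀ᶠ v : IsDedekindDomain.HeightOneSpectrum (NumberField.RingOfIntegers ℚ) in Filter.cofinite, r.IsUnramifiedAt v ∧ σ.IsUnramifiedAt v ∧ σ'.IsUnramifiedAt v ∧ ∃ (P : Polynomial (Valued.integer (PadicAlgCl p))) (P₁ P₂ : Polynomial k), r.HasFrobCharpolyAt v (P.map (Valued.integer (PadicAlgCl p)).subtype) ∧ σ.HasFrobCharpolyAt v P₁ ∧ σ'.HasFrobCharpolyAt v P₂ ∧ P.map red = P₁ * P₂)); let AutGL2 := fun s : Literature.NumberTheory.GaloisRepresentations.FramedGaloisRep ℚ k 2 => (∀ (hcpt₂ : Literature.NumberTheory.Automorphic.isCompact_glFiniteIntegralLevel 2 ℚ) (ι : PadicAlgCl p ≃+* ℂ), ∃ π₂ : Literature.NumberTheory.Automorphic.CuspidalAutomorphicRepData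 2 ℚ hcpt₂, π₂.1.IsLAlgebraic ∧ ∀ᶠ v : IsDedekindDomain.HeightOneSpectrum (NumberField.RingOfIntegers ℚ) in Filter.cofinite, ∃ (a : Multiset ℂ) (P : Polynomial (Valued.integer (PadicAlgCl p))) (Pb : Polynomial k), π₂.1.HasSatakeParamAt v a ∧ P.map (Valued.integer (PadicAlgCl p)).subtype = Literature.NumberTheory.Automorphic.arithFrobPolyOfSatake ι v.residueCard 1 a ∧ s.IsUnramifiedAt v ∧ s.HasFrobCharpolyAt v Pb ∧ P.map red = Pb); AutGL2 σ → AutGL2 σ' → σ.toGaloisRep.IsIrreducible → σ'.toGaloisRep.IsIrreducible → (∀ g, Literature.NumberTheory.GaloisRepresentations.FramedRep.det σ g = (Units.map (ZMod.castHom (dvd_refl p) k).toMonoidHom (εb g))⁻¹ ∧ Literature.NumberTheory.GaloisRepresentations.FramedRep.det σ' g = Literature.NumberTheory.GaloisRepresentations.FramedRep.det σ g) → (∃ ρ : Literature.NumberTheory.GaloisRepresentations.FramedGaloisRep ℚ (PadicAlgCl p) 4, Sh ρ) → ∀ (hcpt : Literature.NumberTheory.Automorphic.isCompact_glFiniteIntegralLevel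 4 ℚ) (ι : PadicAlgCl p ≃+* ℂ), ∃ ρ₀ : Literature.NumberTheory.GaloisRepresentations.FramedGaloisRep ℚ (PadicAlgCl p) 4, ρ₀.toGaloisRep.IsIrreducible ∧ Sh ρ₀ ∧ (∃ π : Literature.NumberTheory.Automorphic.CuspidalAutomorphicRepData 4 ℚ hcpt, π.1.IsLAlgebraic ∧ ∀ᶠ v : IsDedekindDomain.HeightOneSpectrum (NumberField.RingOfIntegers ℚ) in Filter.cofinite, ∃ a : Multiset ℂ, π.1.HasSatakeParamAt v a ∧ ρ₀.IsUnramifiedAt v ∧ ρ₀.HasFrobCharpolyAt v (Literature.NumberTheory.Automorphic.arithFrobPolyOfSatake ι v.residueCard 1 a))) :=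
  stableYoshidaCongruence_iff_dropNonConj.trans Iff.rfl

end Summit.Langlands.Langlands.Theorems.PhantomRMYoshida

end
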